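import Summits.CriticalPhenomena.PercolationContinuityZ3.Theorems.PercNearOneGluingNoHeavyLowerTailSunflowerPiercedPair
import HarnessLib

/-!
# `NoHeavyLowerTail` (crux stmt-CriticalPhenomena-4575), abstract sunflower cubic: the spectator-transfer inequality (♣) behind a petal
# PIERCED BY A PAIR `{s,t}` ONE OF WHOSE POINTS IS A PETAL-`3` SINGLETON

Support file (seat `prim-ineq-gen-2` gen 23; `--supports stmt-CriticalPhenomena-4575`).  No `sorry`, no named facts; nothing is asserted about the crux.
Memo: run/shared/lean/prim/prim-ineq-gen-2/gen23/CLUB-ORPETAL-ALL-R.md §8 (two-point scan for (♣)₃).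

THEOREM `Sunflower.spectatorTransfer_three_of_pierced_pair`: if `s ≠ t`, `lab {t} ∈ {3,4}` (the singleton `{t}` is a petal-`3` or kernel set)
and every set of label `3` meets `{s,t}`, then `2·Nabk 3 ≤ SA + SB + 2·Nkk 3` (`SpectatorTransfer` for the petal `3`).  This strictly contains the
two-point disjunctive petal (`…SpectatorTransferOrPetalPair`, which also needs `lab {s} ∈ {3,4}`): the point `s` is free.  Found by the gen-23 LP scan
of two-point hypotheses for (♣)₃; proof = the architecture of `…SpectatorTransferOrPetalPair` with 17 block codes (`opCode`: free label `≠ 3`,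
`lab (X+t) ∈ {3,4}`, monotone) and TWO row families — plain antipodal Gladkov (weight `opW0`) and the `s`-CONTRACTION rows `kk (lab (S+s)) (lab (T+s))`
(weight `opW1`, `nested_weight_mul_kk_insert_nonneg` of `…SunflowerPiercedPair`) — exact integer certificate, symmetrised kernel `≥ 0` on all `17³`
code triples (`opKer_symm_nonneg`, `decide` on sorted triples).
-/

namespace Summit.CriticalPhenomena.PercolationContinuityZ3.Theorems.SunflowerPartition

open Finset

/-! ## Finite kernels -/

/-- The nine placements of `s,t`, kernel `clubKer`, as a function of the block data. [this work] -/
def nineClub (a b c : BlockData) : ℤ :=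
  clubKer a.2.2.2 b.1 c.1 + clubKer a.2.1 b.2.2.1 c.1 + clubKer a.2.1 b.1 c.2.2.1
    + clubKer a.2.2.1 b.2.1 c.1 + clubKer a.1 b.2.2.2 c.1 + clubKer a.1 b.2.1 c.2.2.1
    + clubKer a.2.2.1 b.1 c.2.1 + clubKer a.1 b.2.2.1 c.2.1 + clubKer a.1 b.1 c.2.2.2

/-- Weight of the plain antipodal-Gladkov row behind a first block with data `a`. [this work] -/
def opW0 (a : BlockData) : ℤ :=
  if a = (0,0,3,4) then 1 else if a = (0,0,4,4) then 1 else if a = (0,1,3,4) then 1 else if a = (0,1,4,4) then 2 else if a = (0,2,3,4) then 1 else if a = (0,2,4,4) then 2 else if a = (0,3,3,4) then 1 else if a = (0,3,4,4) then 1 else if a = (0,4,3,4) then 1 else if a = (1,1,4,4) then 2 else if a = (1,4,4,4) then 2 else if a = (2,2,4,4) then 2 else if a = (2,4,4,4) then 2 else if a = (4,4,4,4) then 2 else 0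

/-- Weight of the `s`-contraction row behind a first block with data `a`. [this work] -/
def opW1 (a : BlockData) : ℤ :=
  if a = (0,0,4,4) then 2 else if a = (0,1,4,4) then 1 else if a = (0,2,4,4) then 1 else if a = (0,3,4,4) then 2 else if a = (0,4,4,4) then 3 else if a = (1,1,4,4) then 1 else if a = (1,4,4,4) then 1 else if a = (2,2,4,4) then 1 else if a = (2,4,4,4) then 1 else if a = (4,4,4,4) then 2 else 0

/-- `opW0 ≥ 0` (all 625 block-data values). [this work] -/
theorem opW0_nonneg_tuple : ∀ x xs xt xst : Fin 5, 0 ≤ opW0 (x, xs, xt, xst) := by decide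

/-- `opW1 ≥ 0` (all 625 block-data values). [this work] -/
theorem opW1_nonneg_tuple : ∀ x xs xt xst : Fin 5, 0 ≤ opW1 (x, xs, xt, xst) := by decide

/-- `opW0 ≥ 0`. [this work] -/
theorem opW0_nonneg (a : BlockData) : 0 ≤ opW0 a := opW0_nonneg_tuple a.1 a.2.1 a.2.2.1 a.2.2.2

/-- `opW1 ≥ 0`. [this work] -/
theorem opW1_nonneg (a : BlockData) : 0 ≤ opW1 a := opW1_nonneg_tuple a.1 a.2.1 a.2.2.1 a.2.2.2

/-- The nine placements minus the two weighted rows of the first block. [this work] -/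
def opKer (a b c : BlockData) : ℤ :=
  nineClub a b c - (opW0 a * kk b.1 c.1 + opW1 a * kk b.2.1 c.2.1)

/-- The 17 block-data values behind a petal pierced by `{s,t}` with `lab {t} ∈ {3,4}` (free label `≠ 3`, `t`-lift `∈ {3,4}`, monotone). [this work] -/
def opCode : Fin 17 → BlockData :=
  ![(0,0,3,3), (0,0,3,4), (0,0,4,4), (0,1,3,4), (0,1,4,4), (0,2,3,4),
    (0,2,4,4), (0,3,3,3), (0,3,3,4), (0,3,4,4), (0,4,3,4), (0,4,4,4),
    (1,1,4,4), (1,4,4,4), (2,2,4,4), (2,4,4,4), (4,4,4,4)]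

/-- Kernel check, first code `0`. [this work] -/
theorem opKer_symm_nonneg_0 : ∀ b c : Fin 17, (0 : Fin 17) ≤ b → b ≤ c → 0 ≤ symm6Of opKer (opCode 0) (opCode b) (opCode c) := by
  decide

/-- Kernel check, first code `1`. [this work] -/
theorem opKer_symm_nonneg_1 : ∀ b c : Fin 17, (1 : Fin 17) ≤ b → b ≤ c → 0 ≤ symm6Of opKer (opCode 1) (opCode b) (opCode c) := by
  decide

/-- Kernel check, first code `2`. [this work] -/
theorem opKer_symm_nonneg_2 : ∀ b c : Fin 17, (2 : Fin 17) ≤ b → b ≤ c → 0 ≤ symm6Of opKer (opCode 2) (opCode b) (opCode c) := by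
  decide

/-- Kernel check, first code `3`. [this work] -/
theorem opKer_symm_nonneg_3 : ∀ b c : Fin 17, (3 : Fin 17) ≤ b → b ≤ c → 0 ≤ symm6Of opKer (opCode 3) (opCode b) (opCode c) := by
  decide

/-- Kernel check, first code `4`. [this work] -/
theorem opKer_symm_nonneg_4 : ∀ b c : Fin 17, (4 : Fin 17) ≤ b → b ≤ c → 0 ≤ symm6Of opKer (opCode 4) (opCode b) (opCode c) := by
  decide

/-- Kernel check, first code `5`. [this work] -/
theorem opKer_symm_nonneg_5 : ∀ b c : Fin 17, (5 : Fin 17) ≤ b → b ≤ c → 0 ≤ symm6Of opKer (opCode 5) (opCode b) (opCode c) := by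
  decide

/-- Kernel check, first code `6`. [this work] -/
theorem opKer_symm_nonneg_6 : ∀ b c : Fin 17, (6 : Fin 17) ≤ b → b ≤ c → 0 ≤ symm6Of opKer (opCode 6) (opCode b) (opCode c) := by
  decide

/-- Kernel check, first code `7`. [this work] -/
theorem opKer_symm_nonneg_7 : ∀ b c : Fin 17, (7 : Fin 17) ≤ b → b ≤ c → 0 ≤ symm6Of opKer (opCode 7) (opCode b) (opCode c) := by
  decide

/-- Kernel check, first code `8`. [this work] -/
theorem opKer_symm_nonneg_8 : ∀ b c : Fin 17, (8 : Fin 17) ≤ b → b ≤ c → 0 ≤ symm6Of opKer (opCode 8) (opCode b) (opCode c) := by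
  decide

/-- Kernel check, first code `9`. [this work] -/
theorem opKer_symm_nonneg_9 : ∀ b c : Fin 17, (9 : Fin 17) ≤ b → b ≤ c → 0 ≤ symm6Of opKer (opCode 9) (opCode b) (opCode c) := by
  decide

/-- Kernel check, first code `10`. [this work] -/
theorem opKer_symm_nonneg_10 : ∀ b c : Fin 17, (10 : Fin 17) ≤ b → b ≤ c → 0 ≤ symm6Of opKer (opCode 10) (opCode b) (opCode c) := by
  decide

/-- Kernel check, first code `11`. [this work] -/
theorem opKer_symm_nonneg_11 : ∀ b c : Fin 17, (11 : Fin 17) ≤ b → b ≤ c → 0 ≤ symm6Of opKer (opCode 11) (opCode b) (opCode c) := by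
  decide

/-- Kernel check, first code `12`. [this work] -/
theorem opKer_symm_nonneg_12 : ∀ b c : Fin 17, (12 : Fin 17) ≤ b → b ≤ c → 0 ≤ symm6Of opKer (opCode 12) (opCode b) (opCode c) := by
  decide

/-- Kernel check, first code `13`. [this work] -/
theorem opKer_symm_nonneg_13 : ∀ b c : Fin 17, (13 : Fin 17) ≤ b → b ≤ c → 0 ≤ symm6Of opKer (opCode 13) (opCode b) (opCode c) := by
  decide

/-- Kernel check, first code `14`. [this work] -/
theorem opKer_symm_nonneg_14 : ∀ b c : Fin 17, (14 : Fin 17) ≤ b → b ≤ c → 0 ≤ symm6Of opKer (opCode 14) (opCode b) (opCode c) := by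
  decide

/-- Kernel check, first code `15`. [this work] -/
theorem opKer_symm_nonneg_15 : ∀ b c : Fin 17, (15 : Fin 17) ≤ b → b ≤ c → 0 ≤ symm6Of opKer (opCode 15) (opCode b) (opCode c) := by
  decide

/-- Kernel check, first code `16`. [this work] -/
theorem opKer_symm_nonneg_16 : ∀ b c : Fin 17, (16 : Fin 17) ≤ b → b ≤ c → 0 ≤ symm6Of opKer (opCode 16) (opCode b) (opCode c) := by
  decide

/-- Kernel check on sorted code triples. [this work] -/
theorem opKer_symm_nonneg_sorted : ∀ a b c : Fin 17, a ≤ b → b ≤ c → 0 ≤ symm6Of opKer (opCode a) (opCode b) (opCode c) := by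
  intro a
  fin_cases a
  · exact opKer_symm_nonneg_0
  · exact opKer_symm_nonneg_1
  · exact opKer_symm_nonneg_2
  · exact opKer_symm_nonneg_3
  · exact opKer_symm_nonneg_4
  · exact opKer_symm_nonneg_5
  · exact opKer_symm_nonneg_6
  · exact opKer_symm_nonneg_7
  · exact opKer_symm_nonneg_8
  · exact opKer_symm_nonneg_9
  · exact opKer_symm_nonneg_10
  · exact opKer_symm_nonneg_11
  · exact opKer_symm_nonneg_12
  · exact opKer_symm_nonneg_13
  · exact opKer_symm_nonneg_14
  · exact opKer_symm_nonneg_15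
  · exact opKer_symm_nonneg_16

/-- **Finite kernel check**: the symmetrised kernel is nonnegative on all `17³` code triples. [this work] -/
theorem opKer_symm_nonneg (a b c : Fin 17) : 0 ≤ symm6Of opKer (opCode a) (opCode b) (opCode c) := by
  have S := opKer_symm_nonneg_sorted
  have P12 := fun x y z : Fin 17 => symm6Of_swap12 opKer (opCode x) (opCode y) (opCode z)
  have P23 := fun x y z : Fin 17 => symm6Of_swap23 opKer (opCode x) (opCode y) (opCode z)
  rcases le_total a b with hab | hba <;> rcases le_total b c with hbc | hcb <;> rcases le_total a c with hac | hca
  · exact S a b c hab hbc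
  · exact S a b c hab hbc
  · rw [P23]; exact S a c b hac hcb
  · rw [P23, P12]; exact S c a b hca hab
  · rw [P12]; exact S b a c hba hac
  · rw [P12, P23]; exact S b c a hbc hca
  · rw [P12, P23, P12]; exact S c b a hcb hba
  · rw [P12, P23, P12]; exact S c b a hcb hba

/-- Admissibility of block data behind a pair-pierced petal, as a Boolean test. [this work] -/
def opAdm (x xs xt xst : Fin 5) : Bool :=
  x ≠ 3 && (xt = 3 || xt = 4) &&
    (x = xs || x = 0 || xs = 4) && (x = xt || x = 0 || xt = 4) && (xs = xst || xs = 0 || xst = 4) && (xt = xst || xt = 0 || xst = 4)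

/-- Every admissible block-data quadruple is one of the 17 codes. [this work] -/
theorem exists_opCode_of : ∀ x xs xt xst : Fin 5, opAdm x xs xt xst = true → ∃ c : Fin 17, opCode c = (x, xs, xt, xst) := by
  decide

/-! ## The theorem -/

variable {α : Type*} [DecidableEq α]

namespace Sunflower

variable (F : Sunflower α)

/-- Behind a petal pierced by `{s,t}` with `lab {t} ∈ {3,4}`, the block data of a set avoiding `s,t` is one of the 17 codes. [this work] -/
theorem exists_opCode {s t : α} (hT : F.lab {t} = 3 ∨ F.lab {t} = 4) (hP : ∀ S : Finset α, F.lab S = 3 → (S ∩ {s, t}).Nonempty)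
    {X : Finset α} (hs : s ∉ X) (ht : t ∉ X) : ∃ c : Fin 17, opCode c = F.blockData s t X := by
  unfold blockData
  have x3 : F.lab X ≠ 3 := by
    intro h3
    obtain ⟨x, hx⟩ := hP X h3
    rw [mem_inter, mem_insert, mem_singleton] at hx
    rcases hx.2 with rfl | rfl
    · exact hs hx.1
    · exact ht hx.1
  have nt : F.lab (insert t X) = 3 ∨ F.lab (insert t X) = 4 := by
    have m := F.lab_mono (singleton_subset_iff.2 (mem_insert_self t X))
    revert m hT; generalize F.lab {t} = u; generalize F.lab (insert t X) = v; revert u v; decide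
  have m1 := F.lab_mono (subset_insert s X)
  have m2 := F.lab_mono (subset_insert t X)
  have m3 := F.lab_mono (insert_subset_insert s (subset_insert t X))
  have m4 := F.lab_mono (subset_insert s (insert t X))
  refine exists_opCode_of _ _ _ _ ?_
  simp only [opAdm, Bool.and_eq_true, Bool.or_eq_true, decide_eq_true_eq, ne_eq, or_assoc]
  exact ⟨⟨⟨⟨⟨x3, nt⟩, m1⟩, m2⟩, m3⟩, m4⟩

/-- **(♣) behind a petal pierced by a pair containing a petal singleton**: if `s ≠ t`, `lab {t} ∈ {3,4}` and every set of label `3` meets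
`{s,t}`, then `2·Nabk 3 ≤ SA + SB + 2·Nkk 3`. [this work] -/
theorem spectatorTransfer_three_of_pierced_pair [Fintype α] {s t : α} (hst : s ≠ t) (hT : F.lab {t} = 3 ∨ F.lab {t} = 4)
    (hP : ∀ S : Finset α, F.lab S = 3 → (S ∩ {s, t}).Nonempty) : 2 * F.Nabk 3 ≤ F.SA + F.SB + 2 * F.Nkk 3 := by
  set E' : Finset α := univ \ {s, t} with hE'
  have hsE : s ∉ E' := fun hh => (mem_sdiff.1 hh).2 (mem_insert_self _ _)
  have htE : t ∉ E' := fun hh => (mem_sdiff.1 hh).2 (mem_insert_of_mem (mem_singleton_self _))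
  have hsW : s ∉ insert t E' := fun hh => by
    rcases mem_insert.1 hh with hh | hh
    · exact hst hh
    · exact hsE hh
  have huniv : (univ : Finset α) = insert s (insert t E') := by
    ext x
    simp only [mem_univ, mem_insert, hE', mem_sdiff, mem_singleton, true_and, true_iff]
    tauto
  set G : Finset α → Finset α → Finset α → ℤ := fun X S T => clubKer (F.lab X) (F.lab S) (F.lab T) with hG
  set L : Finset α → BlockData := F.blockData s t with hL
  have hsplit : nested (insert s (insert t E')) G
      = nested E' (fun X S T => opKer (L X) (L S) (L T))
        + (nested E' (fun X S T => opW0 (L X) * kk (F.lab S) (F.lab T))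
          + nested E' (fun X S T => opW1 (L X) * kk (F.lab (insert s S)) (F.lab (insert s T)))) := by
    rw [nested_insert_split _ s hsW, nested_insert_split _ t htE, nested_insert_split _ t htE, nested_insert_split _ t htE]
    unfold nested
    simp only [hG, hL, blockData, opKer, nineClub, sum_add_distrib, sum_sub_distrib]
    ring
  have hker : 0 ≤ nested E' (fun X S T => opKer (L X) (L S) (L T)) := by
    have h6 := six_mul_nested_eq_symm6Of E' L opKer
    have hpos : 0 ≤ nested E' (fun X S T => symm6Of opKer (L X) (L S) (L T)) := by
      refine nested_nonneg_of_forall E' _ fun X hX S hS => ?_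
      have hT' : (E' \ X) \ S ⊆ E' := sdiff_subset.trans sdiff_subset
      have hS' : S ⊆ E' := hS.trans sdiff_subset
      obtain ⟨a, ha⟩ := F.exists_opCode hT hP (fun hh => hsE (hX hh)) (fun hh => htE (hX hh))
      obtain ⟨b, hb⟩ := F.exists_opCode hT hP (fun hh => hsE (hS' hh)) (fun hh => htE (hS' hh))
      obtain ⟨c, hc⟩ := F.exists_opCode hT hP (fun hh => hsE (hT' hh)) (fun hh => htE (hT' hh))
      rw [hL, ← ha, ← hb, ← hc]
      exact opKer_symm_nonneg a b c
    linarith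
  have hrow0 : 0 ≤ nested E' (fun X S T => opW0 (L X) * kk (F.lab S) (F.lab T)) :=
    F.nested_weight_mul_kk_nonneg E' (fun X => opW0 (L X)) fun X => opW0_nonneg _
  have hrow1 : 0 ≤ nested E' (fun X S T => opW1 (L X) * kk (F.lab (insert s S)) (F.lab (insert s T))) :=
    F.nested_weight_mul_kk_insert_nonneg E' s (fun X => opW1 (L X)) fun X => opW1_nonneg _
  have hQ : F.SA + F.SB + 2 * F.Nkk 3 - 2 * F.Nabk 3 = nested (insert s (insert t E')) G := by
    rw [F.club_eq_sum_parts, sum_parts_eq_nested_univ (fun X S T => clubKer (F.lab X) (F.lab S) (F.lab T)), huniv]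
  rw [hsplit] at hQ
  linarith

end Sunflower

end Summit.CriticalPhenomena.PercolationContinuityZ3.Theorems.SunflowerPartition
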